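import Summits.BirchSwinnertonDyer.BirchSwinnertonDyer.Theorems.ResidualThetaTransportAtTwoCmLambdaLowerOfCorankOfFinite
import Summits.BirchSwinnertonDyer.BirchSwinnertonDyer.Theorems.ResidualThetaTransportAtTwoThetaTransportSelmerSubmodule
import Summits.BirchSwinnertonDyer.BirchSwinnertonDyer.Theorems.ResidualThetaTransportAtTwoResidualSignedLambdaLowerCMAtTwoSelmerDualFinite
import Summits.BirchSwinnertonDyer.BirchSwinnertonDyer.Theorems.ResidualThetaTransportAtTwoResidualSignedLambdaLowerCMAtTwoLambdaAssembly
import Literature.NumberTheory.EllipticCurves.SupersingularModPDecompositionImageProofs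
import HarnessLib

/-!
# RSL_g ⟸ ONE λ-inequality about the Pontryagin dual of THE Selmer module — the N7 entry point of the 22608 line with
# every piece of Pontryagin / Nakayama / Serre / `Λ_𝒪`-structure bookkeeping DISCHARGED (`cmLambdaLower_of_finrank_characterModule`)

Route `ResidualThetaTransportAtTwo` (RTT), crux RSL_g `ResidualSignedLambdaLowerCMAtTwo` (stmt-BirchSwinnertonDyer-22608; the
(R≥)ᵖ crux stmt-BirchSwinnertonDyer-26074 is glue above it). Seat `prover-bsd-wall-rtt-p2` g16 (`--supports`, closes nothing).
THEOREMS ONLY (no definition, no named fact, no instance, no `sorry`); the conclusion is the TEXT of RSL_g verbatim (no `Theses`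
import), so `exact cmLambdaLower_of_finrank_characterModule h` closes 22608 BY NAME in a file importing the route. RSL_g is NOT
proved here (the λ-inequality is the hypothesis); BSD is not proved by any of this.

WHAT. `cmLambdaLower_of_corank_of_finite` (p660988) asks, on the finite branch, for a scalar-stable subgroup `Sg` of the counted
Selmer SET, a `Λ_𝒪`-module `X` finitely generated over `Λ_𝒪` with a bijective scalar-compatible `toDual : X → Hom(Sg, ℚ/ℤ)`, and
`d + Σ_g(S₀) ≤ rank_𝒪(X/X_tors)`. ALL of that except the rank is now kernel: `Sg` = THE Selmer module (w3's
`ThetaTransport.exists_addSubgroup_scalar_stable_selTransported`, with Serre 1972 Prop. 12 DISCHARGED by the tree theorem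
`serre1972_supersingular_decompositionSubgroup_image_holds`), `X = Sg⋆ = CharacterModule Sg` with its `Λ_𝒪`-structure
`T = conj_γ − 1` (w2's `exists_dualPair_of_stable`) over Mathlib's `𝒪`-structure `(a•φ)(s) = φ(a•s)` (the `𝒪`-module structure of
`Sg` being `scalarH1`, EPW §3.1), `Module.Finite` from «μ = 0 for free» (`module_finite_characterModule_of_finite_scalarH1_torsion`,
this seat), and the corank currency converted to λ-currency (`CharIdealLambda.le_finrank_quotientTorsion_of_le_finrank_baseChange`).

* **`cmLambdaLower_of_finrank_characterModule`** — RSL_g ⟸ «for every datum of RSL_g, every additive subgroup `Sg` that IS the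
  Selmer set (membership iff the three clauses), stable under `conj_τ`, carrying an `𝒪`-module structure with scalars `scalarH1`,
  on the finite branch: `d + Σ_g(S₀) ≤ dim_K (K ⊗_𝒪 Sg⋆)`, `K = Frac 𝒪`» — exactly the currency in which the duality kit of this
  seat concludes (`CharIdealLambda.le_finrank_baseChange_characterModule_of_duality` (N5),
  `CharIdealLambda.add_le_finrank_baseChange_characterModule_of_res` (N6)).

References: [EmertonPollackWeston2006] §3.1, Thm. 3.1.1; [Greenberg2006] §3 A; [GreenbergLNM1716] §1, §4; [SerreInventiones1972] §1.11 Prop. 12.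
-/

set_option autoImplicit false
-- the Theorems namespace of this sub repeats the summit name by design (D-0017 nested layout)
set_option linter.dupNamespace false
-- the 3900-character binder blocks of the registered RSL_g signature need more than the default budget to elaborate (as in p645378 / p660988)
set_option maxHeartbeats 800000

noncomputable section

open scoped Classical TensorProduct

namespace Summit.BirchSwinnertonDyer.BirchSwinnertonDyer.Theorems.LambdaLowerBoundO

open Literature.NumberTheory.EllipticCurves Literature.NumberTheory.EllipticCurves.GreenbergSelmer
open Literature.NumberTheory.GaloisRepresentations NumberField IsDedekindDomain Field
open Literature.NumberTheory.EllipticCurves GreenbergSelmer GreenbergVatsal2000 Kobayashi2003 ModularForms Rank1Residual Literature.NumberTheory.GaloisRepresentations Literature.NumberTheory.Automorphic IsDedekindDomain NumberField Field Rat.HeightOneSpectrum PowerSeries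

/-- **RSL_g ⟸ the λ-inequality `d + Σ_g(S₀) ≤ dim_K(K ⊗_𝒪 Sel⁺_{S₀}(ℚ_∞, A_g)⋆)` on the finite branch** (N7 entry with all
bookkeeping discharged). Hypothesis: for every datum of RSL_g, every additive subgroup `Sg ≤ H¹(Γ_{ℚ_∞}, A_g)` whose members are
exactly the classes satisfying the three Selmer clauses (unramified outside `2S₀`, archimedean, transported plus-Kummer at `2`),
stable under every `conj_τ`, with an `𝒪`-module structure whose scalars are `scalarH1`, and with `𝒮[ϖ]` finite:
`d + Σ_g(S₀) ≤ dim_{Frac 𝒪}(Frac 𝒪 ⊗_𝒪 CharacterModule Sg)`. Conclusion: the text of RSL_g (stmt-BirchSwinnertonDyer-22608)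
VERBATIM. Proof: `cmLambdaLower_of_corank_of_finite` with `Sg` from `ThetaTransport.exists_addSubgroup_scalar_stable_selTransported`
(Serre discharged), `X = CharacterModule Sg` with w2's `Λ_𝒪`-structure, `Module.Finite` from co-Nakayama, corank from λ.
[cite: EmertonPollackWeston2006, §3.1 and Thm. 3.1.1] [cite: Greenberg2006, §3 A (proof of Prop. 3.2)] [cite: GreenbergLNM1716, §4 p. 98] -/
theorem cmLambdaLower_of_finrank_characterModule
    (hlam :
    open Literature.NumberTheory.EllipticCurves GreenbergSelmer GreenbergVatsal2000 Kobayashi2003 ModularForms Rank1Residual Literature.NumberTheory.GaloisRepresentations Literature.NumberTheory.Automorphic IsDedekindDomain NumberField Field Rat.HeightOneSpectrum PowerSeries in ∀ (W : WeierstrassCurve ℚ) [W.IsElliptic] [W.IsGloballyMinimal], ¬ W.HasCM → W.analyticRank = 0 → GoodSS W 2 → W.frobeniusTrace 2 = 0 → W.Δ < 0 → ∀ (M : ℕ) [NeZero M] (g : CuspForm (CongruenceSubgroup.Gamma0 M) 2) (ι : coeffField g →+* PadicAlgCl 2) (Ω : ℂ), Odd M → IsNewform0 g → IsCMForm (liftToGamma1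 M 2 g) → cuspCoeff g 2 = 0 → IsCohomologicalPlusPeriod g ι Ω → (∀ ℓ : ℕ, ℓ.Prime → ¬ ℓ ∣ 2 * M * W.conductorNorm ℤ → ‖embCoeff g ι ℓ - (W.frobeniusTrace ℓ : PadicAlgCl 2)‖ < 1) → ∀ (κ : ZpExtension ℚ 2) (γ : absoluteGaloisGroup ℚ), κ.IsCyclotomic → κ.IsTopGenerator γ → IsCyclotomicVariable 2 γ → ∀ (S₀ : Finset (HeightOneSpectrum (RingOfIntegers ℚ))), (∀ v ∈ S₀, ((2 : ℕ) : RingOfIntegers ℚ) ∉ v.asIdeal) → (∀ v, ¬ W.HasGoodReductionAt v → v ∈ S₀) → (∀ v, natGenerator v ∣ M → v ∈ S₀) → ∀ (Lp Lm : IwasawaAlgebraO (Set.range ι)) (d : ℕ), IsPollackPairK g ι Ω Lp Lm → (∀ k, ‖coeff k (iwasawaOToPowerSeries (Set.range ι) Lm)‖ ≤ ‖coeff d (iwasawaOToPowerSeries (Set.range ι) Lm)‖) → (∀ k < d, ‖coeff k (iwasawaOToPowerSeries (Set.range ι) Lm)‖ < ‖coeff d (iwasawaOToPowerSeries (Set.range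 ι) Lm)‖) → ∀ (n : ℕ) (ρ : FramedGaloisRep ℚ ↥(padicCoeffIntegers (Set.range ι)) 2) (Θ : ∀ v : HeightOneSpectrum (RingOfIntegers ℚ), ((2 : ℕ) : RingOfIntegers ℚ) ∈ v.asIdeal → (Cofree ρ ↥(padicCoeffField (Set.range ι)) ≃+ (Fin n → ↥(W.geomPrimaryTorsion 2)))), (∀ v, ¬ natGenerator v ∣ 2 * M → ρ.IsUnramifiedAt v ∧ ∃ P : Polynomial ↥(padicCoeffIntegers (Set.range ι)), P.map (padicCoeffIntegers (Set.range ι)).subtype = Polynomial.X ^ 2 - Polynomial.C (embCoeff g ι (natGenerator v)) * Polynomial.X + Polynomial.C ((natGenerator v : ℕ) : PadicAlgCl 2) ∧ ρ.HasFrobCharpolyAt v P) → (∀ v hv (δ : absoluteGaloisGroup (v.adicCompletion ℚ)) m i, Θ v hv (resGalOfEmb (closureEmb (K := ℚ) (v.adicCompletion ℚ)) δ • m) i = resGalOfEmb (closureEmb (K := ℚ) (v.adicCompletion ℚ)) δ • Θ v hv m i) → ∀ (ϖ : ↥(padicCoeffIntegers (Set.range ι))), Irreducible ϖ → ∀ (Sg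 : AddSubgroup (subgroupH1 κ.kerSubgroup (Cofree ρ ↥(padicCoeffField (Set.range ι))))) [Module ↥(padicCoeffIntegers (Set.range ι)) ↥Sg], (∀ (a : ↥(padicCoeffIntegers (Set.range ι))) (s : ↥Sg), ((a • s : ↥Sg) : subgroupH1 κ.kerSubgroup (Cofree ρ ↥(padicCoeffField (Set.range ι)))) = scalarH1 κ.kerSubgroup (Cofree ρ ↥(padicCoeffField (Set.range ι))) a s) → (∀ y : subgroupH1 κ.kerSubgroup (Cofree ρ ↥(padicCoeffField (Set.range ι))), y ∈ Sg ↔ y ∈ {y : subgroupH1 κ.kerSubgroup (Cofree ρ ↥(padicCoeffField (Set.range ι))) | y ∈ unramifiedOutside κ.kerSubgroup (Cofree ρ ↥(padicCoeffField (Set.range ι))) 2 ↑S₀ ∧ (∀ w σ, conjH1 κ.kerSubgroup (Cofree ρ ↥(padicCoeffField (Set.range ι))) σ y ∈ infKer κ.kerSubgroup (Cofree ρ ↥(padicCoeffField (Set.range ι))) w) ∧ (∀ v hv σ, ∃ (φ : _) (Q : Fin n → localPoints W (v.adicCompletion ℚ)) (k : ℕ), oneCocycleClass (discreteTopRep ↥κ.kerSubgroup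 (Cofree ρ ↥(padicCoeffField (Set.range ι)))) φ = conjH1 κ.kerSubgroup (Cofree ρ ↥(padicCoeffField (Set.range ι))) σ y ∧ (∀ i, (2 ^ k) • Q i ∈ ⨆ m : ℕ, signedLocalPoints κ (v.adicCompletion ℚ) W 1 m) ∧ ∀ τ i, pointsMapOfEmb W (closureEmb (K := ℚ) (v.adicCompletion ℚ)) (((Θ v hv (φ.1 (resGalSubgroupOfEmb κ.kerSubgroup (closureEmb (K := ℚ) (v.adicCompletion ℚ)) τ))) i : ↥(W.geomPrimaryTorsion 2)) : W.geomPoints) = (τ : absoluteGaloisGroup (v.adicCompletion ℚ)) • Q i - Q i)}) → (∀ (τ : absoluteGaloisGroup ℚ) (y : subgroupH1 κ.kerSubgroup (Cofree ρ ↥(padicCoeffField (Set.range ι)))), y ∈ Sg → conjH1 κ.kerSubgroup (Cofree ρ ↥(padicCoeffField (Set.range ι))) τ y ∈ Sg) → ({y : subgroupH1 κ.kerSubgroup (Cofree ρ ↥(padicCoeffField (Set.range ι))) | y ∈ unramifiedOutside κ.kerSubgroup (Cofree ρ ↥(padicCoeffField (Set.range ι))) 2 ↑S₀ ∧ (∀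 w σ, conjH1 κ.kerSubgroup (Cofree ρ ↥(padicCoeffField (Set.range ι))) σ y ∈ infKer κ.kerSubgroup (Cofree ρ ↥(padicCoeffField (Set.range ι))) w) ∧ (∀ v hv σ, ∃ (φ : _) (Q : Fin n → localPoints W (v.adicCompletion ℚ)) (k : ℕ), oneCocycleClass (discreteTopRep ↥κ.kerSubgroup (Cofree ρ ↥(padicCoeffField (Set.range ι)))) φ = conjH1 κ.kerSubgroup (Cofree ρ ↥(padicCoeffField (Set.range ι))) σ y ∧ (∀ i, (2 ^ k) • Q i ∈ ⨆ m : ℕ, signedLocalPoints κ (v.adicCompletion ℚ) W 1 m) ∧ ∀ τ i, pointsMapOfEmb W (closureEmb (K := ℚ) (v.adicCompletion ℚ)) (((Θ v hv (φ.1 (resGalSubgroupOfEmb κ.kerSubgroup (closureEmb (K := ℚ) (v.adicCompletion ℚ)) τ))) i : ↥(W.geomPrimaryTorsion 2)) : W.geomPoints) = (τ : absoluteGaloisGroup (v.adicCompletion ℚ)) • Q i - Q i) ∧ scalarH1 κ.kerSubgroup (Cofree ρ ↥(padicCoeffField (Set.range ι))) ϖ y = 0} : Set _).Finite → (d + ∑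 v ∈ S₀, 2 ^ padicValNat 2 ((natGenerator v ^ 2 - 1) / 8) * (if natGenerator v ∣ M then (if ‖embCoeff g ι (natGenerator v) - 1‖ < 1 then 1 else 0) else (if ‖embCoeff g ι (natGenerator v)‖ < 1 then 2 else 0))) ≤ Module.finrank (FractionRing ↥(padicCoeffIntegers (Set.range ι))) (TensorProduct ↥(padicCoeffIntegers (Set.range ι)) (FractionRing ↥(padicCoeffIntegers (Set.range ι))) (CharacterModule ↥Sg))) :
    open Literature.NumberTheory.EllipticCurves GreenbergSelmer GreenbergVatsal2000 Kobayashi2003 ModularForms Rank1Residual Literature.NumberTheory.GaloisRepresentations Literature.NumberTheory.Automorphic IsDedekindDomain NumberField Field Rat.HeightOneSpectrum PowerSeries in ∀ (W : WeierstrassCurve ℚ) [W.IsElliptic] [W.IsGloballyMinimal], ¬ W.HasCM → W.analyticRank = 0 → GoodSS W 2 → W.frobeniusTrace 2 = 0 → W.Δ < 0 → ∀ (M : ℕ) [NeZero M] (g : CuspForm (CongruenceSubgroup.Gamma0 M) 2) (ι : coeffField g →+* PadicAlgCl 2) (Ω : ℂ), Odd M → IsNewform0 g → IsCMForm (liftToGamma1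 M 2 g) → cuspCoeff g 2 = 0 → IsCohomologicalPlusPeriod g ι Ω → (∀ ℓ : ℕ, ℓ.Prime → ¬ ℓ ∣ 2 * M * W.conductorNorm ℤ → ‖embCoeff g ι ℓ - (W.frobeniusTrace ℓ : PadicAlgCl 2)‖ < 1) → ∀ (κ : ZpExtension ℚ 2) (γ : absoluteGaloisGroup ℚ), κ.IsCyclotomic → κ.IsTopGenerator γ → IsCyclotomicVariable 2 γ → ∀ (S₀ : Finset (HeightOneSpectrum (RingOfIntegers ℚ))), (∀ v ∈ S₀, ((2 : ℕ) : RingOfIntegers ℚ) ∉ v.asIdeal) → (∀ v, ¬ W.HasGoodReductionAt v → v ∈ S₀) → (∀ v, natGenerator v ∣ M → v ∈ S₀) → ∀ (Lp Lm : IwasawaAlgebraO (Set.range ι)) (d : ℕ), IsPollackPairK g ι Ω Lp Lm → (∀ k, ‖coeff k (iwasawaOToPowerSeries (Set.range ι) Lm)‖ ≤ ‖coeff d (iwasawaOToPowerSeries (Set.range ι) Lm)‖) → (∀ k < d, ‖coeff k (iwasawaOToPowerSeries (Set.range ι) Lm)‖ < ‖coeff d (iwasawaOToPowerSeries (Set.range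 ι) Lm)‖) → ∀ (n : ℕ) (ρ : FramedGaloisRep ℚ ↥(padicCoeffIntegers (Set.range ι)) 2) (Θ : ∀ v : HeightOneSpectrum (RingOfIntegers ℚ), ((2 : ℕ) : RingOfIntegers ℚ) ∈ v.asIdeal → (Cofree ρ ↥(padicCoeffField (Set.range ι)) ≃+ (Fin n → ↥(W.geomPrimaryTorsion 2)))), (∀ v, ¬ natGenerator v ∣ 2 * M → ρ.IsUnramifiedAt v ∧ ∃ P : Polynomial ↥(padicCoeffIntegers (Set.range ι)), P.map (padicCoeffIntegers (Set.range ι)).subtype = Polynomial.X ^ 2 - Polynomial.C (embCoeff g ι (natGenerator v)) * Polynomial.X + Polynomial.C ((natGenerator v : ℕ) : PadicAlgCl 2) ∧ ρ.HasFrobCharpolyAt v P) → (∀ v hv (δ : absoluteGaloisGroup (v.adicCompletion ℚ)) m i, Θ v hv (resGalOfEmb (closureEmb (K := ℚ) (v.adicCompletion ℚ)) δ • m) i = resGalOfEmb (closureEmb (K := ℚ) (v.adicCompletion ℚ)) δ • Θ v hv m i) → ∀ (ϖ : ↥(padicCoeffIntegers (Set.range ι))), Irreducible ϖ → ((Nat.card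 (↥(padicCoeffIntegers (Set.range ι)) ⧸ Ideal.span {ϖ}) ^ (d + ∑ v ∈ S₀, 2 ^ padicValNat 2 ((natGenerator v ^ 2 - 1) / 8) * (if natGenerator v ∣ M then (if ‖embCoeff g ι (natGenerator v) - 1‖ < 1 then 1 else 0) else (if ‖embCoeff g ι (natGenerator v)‖ < 1 then 2 else 0))) : ℕ) : ℕ∞) ≤ {y : subgroupH1 κ.kerSubgroup (Cofree ρ ↥(padicCoeffField (Set.range ι))) | y ∈ unramifiedOutside κ.kerSubgroup (Cofree ρ ↥(padicCoeffField (Set.range ι))) 2 ↑S₀ ∧ (∀ w σ, conjH1 κ.kerSubgroup (Cofree ρ ↥(padicCoeffField (Set.range ι))) σ y ∈ infKer κ.kerSubgroup (Cofree ρ ↥(padicCoeffField (Set.range ι))) w) ∧ (∀ v hv σ, ∃ (φ : _) (Q : Fin n → localPoints W (v.adicCompletion ℚ)) (k : ℕ), oneCocycleClass (discreteTopRep ↥κ.kerSubgroup (Cofree ρ ↥(padicCoeffField (Set.range ι)))) φ = conjH1 κ.kerSubgroup (Cofree ρ ↥(padicCoeffField (Set.range ι))) σ y ∧ (∀ i,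 (2 ^ k) • Q i ∈ ⨆ m : ℕ, signedLocalPoints κ (v.adicCompletion ℚ) W 1 m) ∧ ∀ τ i, pointsMapOfEmb W (closureEmb (K := ℚ) (v.adicCompletion ℚ)) (((Θ v hv (φ.1 (resGalSubgroupOfEmb κ.kerSubgroup (closureEmb (K := ℚ) (v.adicCompletion ℚ)) τ))) i : ↥(W.geomPrimaryTorsion 2)) : W.geomPoints) = (τ : absoluteGaloisGroup (v.adicCompletion ℚ)) • Q i - Q i) ∧ scalarH1 κ.kerSubgroup (Cofree ρ ↥(padicCoeffField (Set.range ι))) ϖ y = 0}.encard := by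
  refine cmLambdaLower_of_corank_of_finite ?_
  intro W _ _ hCM hr0 hss ha2 hΔ M _ g ι Ω hM hnew hcmf ha2g hΩ hcong κ γ hκ hγ hcyc S₀ hS₀ hbad hMS Lp Lm d hpair
    hle hlt n ρ Θ hρ hΘ ϖ hϖ hfin
  haveI : FiniteDimensional ℚ (ModularForms.coeffField g) :=
    ModularForms.IsNewform0.finiteDimensional_coeffField_holds hnew
  haveI : FiniteDimensional ℚ_[2] ↥(padicCoeffField (Set.range ι)) :=
    GreenbergSelmer.finiteDimensional_padicCoeffField ι
  haveI : IsDiscreteValuationRing ↥(padicCoeffIntegers (Set.range ι)) :=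
    PollackPairK.isDiscreteValuationRing_padicCoeffIntegers
  -- THE Selmer module (w3; Serre 1972 Prop. 12 discharged); `Exists.elim`, no pattern matching against the large goal
  refine (ThetaTransport.exists_addSubgroup_scalar_stable_selTransported W
      serre1972_supersingular_decompositionSubgroup_image_holds hss ha2 κ S₀ n ρ Θ hΘ).elim fun Sg hSg ↦ ?_
  have hscal := hSg.1
  have hconj := hSg.2.1
  have hmem := hSg.2.2.1
  have hset := hSg.2.2.2
  -- its `𝒪`-module structure through `scalarH1` (a ring action: `scalarH1_one/_mul/_zero/_add`)
  let σ : ↥(padicCoeffIntegers (Set.range ι)) →+* AddMonoid.End ↥Sg :=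
    { toFun := fun r ↦ ((scalarH1 κ.kerSubgroup (Cofree ρ ↥(padicCoeffField (Set.range ι))) r).restrict
          Sg).codRestrict Sg fun s ↦ hscal r _ s.2
      map_one' := by
        refine DFunLike.ext _ _ fun s ↦ Subtype.ext ?_
        exact DFunLike.congr_fun (scalarH1_one κ.kerSubgroup (Cofree ρ ↥(padicCoeffField (Set.range ι)))
          (R := ↥(padicCoeffIntegers (Set.range ι)))) (s : subgroupH1 κ.kerSubgroup (Cofree ρ ↥(padicCoeffField (Set.range ι))))
      map_mul' := by
        intro r r'
        refine DFunLike.ext _ _ fun s ↦ Subtype.ext ?_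
        exact DFunLike.congr_fun (scalarH1_mul κ.kerSubgroup (Cofree ρ ↥(padicCoeffField (Set.range ι))) r r')
          (s : subgroupH1 κ.kerSubgroup (Cofree ρ ↥(padicCoeffField (Set.range ι))))
      map_zero' := by
        refine DFunLike.ext _ _ fun s ↦ Subtype.ext ?_
        exact DFunLike.congr_fun (scalarH1_zero κ.kerSubgroup (Cofree ρ ↥(padicCoeffField (Set.range ι)))
          (R := ↥(padicCoeffIntegers (Set.range ι)))) (s : subgroupH1 κ.kerSubgroup (Cofree ρ ↥(padicCoeffField (Set.range ι))))
      map_add' := by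
        intro r r'
        refine DFunLike.ext _ _ fun s ↦ Subtype.ext ?_
        exact DFunLike.congr_fun (scalarH1_add κ.kerSubgroup (Cofree ρ ↥(padicCoeffField (Set.range ι))) r r')
          (s : subgroupH1 κ.kerSubgroup (Cofree ρ ↥(padicCoeffField (Set.range ι)))) }
  letI instSg : Module ↥(padicCoeffIntegers (Set.range ι)) ↥Sg := Module.compHom ↥Sg σ
  have hsmul : ∀ (a : ↥(padicCoeffIntegers (Set.range ι))) (s : ↥Sg),
      ((a • s : ↥Sg) : subgroupH1 κ.kerSubgroup (Cofree ρ ↥(padicCoeffField (Set.range ι)))) =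
        scalarH1 κ.kerSubgroup (Cofree ρ ↥(padicCoeffField (Set.range ι))) a s := fun _ _ ↦ rfl
  -- finiteness of `Sg[ϖ]` (w3: the counted set IS `Sg[ϖ]`) and «μ = 0 for free»
  have hfin' : {c : subgroupH1 κ.kerSubgroup (Cofree ρ ↥(padicCoeffField (Set.range ι))) |
      c ∈ Sg ∧ scalarH1 κ.kerSubgroup (Cofree ρ ↥(padicCoeffField (Set.range ι))) ϖ c = 0}.Finite := by
    rw [← hset ϖ]; exact hfin
  haveI hfinO : Module.Finite ↥(padicCoeffIntegers (Set.range ι)) (CharacterModule ↥Sg) :=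
    module_finite_characterModule_of_finite_scalarH1_torsion (Set.range ι) κ ρ Sg hsmul hϖ hfin'
  -- the `Λ_𝒪`-structure `T = conj_γ − 1` on `Sg⋆` (w2), as a scalar tower over Mathlib's `𝒪`-structure
  refine (exists_dualPair_of_stable (Set.range ι) κ hγ ρ Sg (fun hc ↦ hconj γ _ hc)
    (fun r _ hc ↦ hscal r _ hc)).elim fun instΛ h2 ↦ ?_
  refine h2.elim fun inst𝒪' h3 ↦ ?_
  have hC := h3.2.2
  letI instΛX : Module (IwasawaAlgebraO (Set.range ι)) (CharacterModule ↥Sg) := instΛ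
  haveI htower : IsScalarTower ↥(padicCoeffIntegers (Set.range ι)) (IwasawaAlgebraO (Set.range ι)) (CharacterModule ↥Sg) := by
    refine IsScalarTower.of_algebraMap_smul fun a x ↦ ?_
    refine CharacterModule.ext _ fun s ↦ ?_
    have h1 : algebraMap ↥(padicCoeffIntegers (Set.range ι)) (IwasawaAlgebraO (Set.range ι)) a =
        (PowerSeries.C a : IwasawaAlgebraO (Set.range ι)) := by
      simp only [PowerSeries.algebraMap_apply, Algebra.algebraMap_self, RingHom.id_apply]
    rw [h1, CharacterModule.smul_apply]
    exact hC a x s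
  haveI : Module.Finite (IwasawaAlgebraO (Set.range ι)) (CharacterModule ↥Sg) :=
    Module.Finite.of_restrictScalars_finite ↥(padicCoeffIntegers (Set.range ι)) (IwasawaAlgebraO (Set.range ι)) _
  -- the λ-inequality, converted to the corank currency
  have hrank := hlam W hCM hr0 hss ha2 hΔ M g ι Ω hM hnew hcmf ha2g hΩ hcong κ γ hκ hγ hcyc S₀ hS₀ hbad hMS Lp Lm d hpair
    hle hlt n ρ Θ hρ hΘ ϖ hϖ Sg hsmul hmem hconj hfin
  refine ⟨Sg, fun y hy ↦ (hmem y).1 hy, fun r c hc ↦ hscal r c hc, CharacterModule ↥Sg, inferInstance, instΛ, inferInstance,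
    htower, ‹_›, AddMonoidHom.id _, Function.bijective_id, fun a x s _ ↦ hC a x s, ?_⟩
  exact CharIdealLambda.le_finrank_quotientTorsion_of_le_finrank_baseChange (FractionRing ↥(padicCoeffIntegers (Set.range ι))) hrank

end Summit.BirchSwinnertonDyer.BirchSwinnertonDyer.Theorems.LambdaLowerBoundO

end
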